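import Literature.Combinatorics.StablePolynomials.RealStableSubspaceDimension
import Literature.Combinatorics.StablePolynomials.PderivProperPosition
import Literature.Combinatorics.StablePolynomials.BasicProofs
import Literature.Combinatorics.StablePolynomials.GraceWalshSzego
import Mathlib.LinearAlgebra.Basis.VectorSpace
import HarnessLib

/-!
# Real stability preservers on multi-affine polynomials (Borcea–Brändén I, Theorem 1.2, case `κ = (1,…,1)`), I:
# the real symbol, Proposition 4.1, and sufficiency

J. Borcea, P. Brändén, *The Lee–Yang and Pólya–Schur programs. I. Linear operators preserving stability*,
Invent. Math. 177 (2009) 541–569 (arXiv:0809.0401), §1.1: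

> **Theorem 1.2.** Let `κ ∈ ℕⁿ` and `T : ℝ_κ[z_1,…,z_n] → ℝ[z_1,…,z_n]` be a linear operator. Then `T`
> preserves real stability if and only if either
> (a) `T` has range of dimension no greater than two and is of the form `T(f) = α(f)P + β(f)Q`, where
> `α, β : ℝ_κ[z_1,…,z_n] → ℝ` are linear functionals and `P, Q` are real stable polynomials such that
> `P ≪ Q`, or
> (b) `G_T(z,w) ∈ 𝓗_{2n}(ℝ)`, or
> (c) `G_T(z,-w) ∈ 𝓗_{2n}(ℝ)`.

(`G_T(z,w) = T[(z+w)^κ] = Σ_{α ≤ κ} binom(κ,α) T(z^α) w^{κ-α}`, §1.1; `P ≪ Q`: Definition 1.1, the tree's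
`IsProperPosition`; "preserves real stability": maps real stable polynomials to real stable polynomials or
to `0`.) And §4:

> **Proposition 4.1.** For any `n ∈ ℕ` the following holds:
> `𝓗_n(ℂ) ∩ 𝓗_n^-(ℂ) = ℂ𝓗_n(ℝ) := {cf : c ∈ ℂ, f ∈ 𝓗_n(ℝ)}`, where `𝓗_n^-(ℂ) = {f(-z) : f ∈ 𝓗_n(ℂ)}`.

This file treats the multi-affine case `κ = (1,…,1)` (the tree's `IsMultiAffine`; the operator `T` is an
`ℝ`-linear endomorphism of `MvPolynomial σ ℝ` constrained only on multi-affine inputs, exactly as in the tree's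
complex companion `BorceaBranden2009_multiAffine_stabilityPreserver_iff`). It supplies the vocabulary, the
**sufficiency** half of Theorem 1.2 and Proposition 4.1; the necessity half is left to a companion file.

## Contents (namespace `Literature.Combinatorics.StablePolynomials`)

* `realMultiAffineSymbol T` — the real symbol `G_T(z,w) = Σ_S T(z^S) w^{[n]∖S} ∈ ℝ[z,w]` (variables `σ ⊕ σ`);
  `negInr` — the sign change `w ↦ -w`, so that (c) reads `IsRealStable (negInr (realMultiAffineSymbol T))`;
  `complexify T` — the complexification `T_ℂ` (`complexify_map`: `T_ℂ(f) = T(f)` on real `f`;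
  `multiAffineSymbol_complexify`: `G_{T_ℂ} = G_T`).
* `symbolAt T W = Σ_S W^{[n]∖S} · T(z^S) = T_ℂ[(z+W)^{[n]}] = G_T(·,W)` and the real and imaginary parts
  `reProdXAddC W`, `imProdXAddC W` of `(z+W)^{[n]}` (`symbolAt_eq`: `G_T(·,W) = T(F_W) + i T(G_W)`;
  `eval_map_realMultiAffineSymbol`: `G_T(z,W) = G_T(·,W)(z)`).
* `negVars` — `f(z) ↦ f(-z)`; `isRealStable_negVars_iff` (`f(-z)` is real stable iff `f` is, for real `f`);
  `negTwist T` (`T'(f) = (-1)ⁿ T(f(-z))`) and `realMultiAffineSymbol_negTwist` (`G_{T'}(z,w) = G_T(z,-w)`, §4: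
  "if `G_{T'}(z,w) = G_T(z,-w)` then `T'(f)(z) = (-1)^κ T(f(-z))`").
* **Proposition 4.1**: `exists_eq_C_mul_map_of_stable_of_stable_negVars` (and the converse inclusion
  `isUpperHalfPlaneStable_negVars_C_mul_map`).
* **Theorem 1.2, sufficiency** (`κ = (1,…,1)`): `realStabilityPreserver_of_rankTwo` ((a) ⇒),
  `realStabilityPreserver_of_symbol` ((b) ⇒, through the complex Lemma 2.2 of the tree applied to `T_ℂ`),
  `realStabilityPreserver_of_symbol_neg` ((c) ⇒, through `T'`), combined in
  `realStabilityPreserver_of_rankTwo_or_symbol`.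

## References

* J. Borcea, P. Brändén, *The Lee–Yang and Pólya–Schur programs. I. Linear operators preserving stability*,
  Invent. Math. 177 (2009) 541–569; arXiv:0809.0401: §1.1 Thm. 1.2, Def. 1.1; §2.1 Lemma 2.2; §4 Prop. 4.1
  and the proof of Thm. 1.2. [BorceaBranden2009]
-/

noncomputable section

open MvPolynomial Finset
open scoped ComplexConjugate

namespace Literature.Combinatorics.StablePolynomials

variable {σ : Type*}

/-! ## §1 Real/complex bookkeeping -/

section Basics

/-- Multi-affinity is unchanged by complexification. [cite: BorceaBranden2009, §2.1 (multi-affine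
polynomials; `ℝ_κ ⊆ ℂ_κ`)] -/
theorem isMultiAffine_map_algebraMap_iff {f : MvPolynomial σ ℝ} :
    IsMultiAffine (map (algebraMap ℝ ℂ) f) ↔ IsMultiAffine f := by
  rw [isMultiAffine_iff_support, isMultiAffine_iff_support,
    support_map_of_injective f (algebraMap ℝ ℂ).injective]

/-- The coefficient form with real coefficients is multi-affine. [cite: BorceaBranden2009, §2.1 (multi-affine
`Σ_S a(S) z^S`)] -/
theorem isMultiAffine_multiAffine_real [Fintype σ] (a : Finset σ → ℝ) : IsMultiAffine (multiAffine a) :=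
  isMultiAffine_map_algebraMap_iff.1 (by rw [map_multiAffine]; exact isMultiAffine_multiAffine _)

/-- A real multi-affine polynomial in coefficient form `Σ_S [z^S]f · z^S`. [cite: BorceaBranden2009, §2.1] -/
theorem eq_multiAffine_of_isMultiAffine_real [Fintype σ] {f : MvPolynomial σ ℝ} (hf : IsMultiAffine f) :
    f = multiAffine fun S => coeff (∑ i ∈ S, Finsupp.single i 1) f := by
  classical
  apply map_injective (algebraMap ℝ ℂ) (algebraMap ℝ ℂ).injective
  rw [map_multiAffine, eq_multiAffine_of_isMultiAffine (isMultiAffine_map_algebraMap hf)]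
  congr 1

/-- `map g + i · map f = 0` iff `f = g = 0` (real and imaginary parts of the coefficients).
[cite: BorceaBranden2009, §4 proof of Thm. 1.2 ("write `(z+W)^κ = F(z) + iG(z)`, `F, G ∈ ℝ_κ[z]`")] -/
theorem map_add_C_I_mul_map_eq_zero_iff (f g : MvPolynomial σ ℝ) :
    map (algebraMap ℝ ℂ) g + C Complex.I * map (algebraMap ℝ ℂ) f = 0 ↔ f = 0 ∧ g = 0 := by
  constructor
  · intro h
    have hc : ∀ m : σ →₀ ℕ, coeff m f = 0 ∧ coeff m g = 0 := fun m => by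
      have h1 := congrArg (coeff m) h
      rw [coeff_add, coeff_C_mul, coeff_map, coeff_map, coeff_zero] at h1
      have hre := congrArg Complex.re h1
      have him := congrArg Complex.im h1
      simp only [Complex.coe_algebraMap, Complex.add_re, Complex.ofReal_re, Complex.mul_re, Complex.I_re,
        zero_mul, Complex.I_im, Complex.ofReal_im, mul_zero, sub_zero, add_zero, Complex.zero_re,
        Complex.add_im, Complex.mul_im, one_mul, zero_add, Complex.zero_im] at hre him
      exact ⟨him, hre⟩
    exact ⟨MvPolynomial.ext _ _ fun m => by rw [(hc m).1, coeff_zero],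
      MvPolynomial.ext _ _ fun m => by rw [(hc m).2, coeff_zero]⟩
  · rintro ⟨rfl, rfl⟩
    simp

/-- `∏_{i ∈ S} (-f i) = (-1)^{|S|} ∏_{i ∈ S} f i`. [folklore] -/
private theorem prod_neg_eq {ι A : Type*} [CommRing A] (S : Finset ι) (f : ι → A) :
    ∏ i ∈ S, -f i = (-1) ^ S.card * ∏ i ∈ S, f i := by
  rw [← prod_const, ← prod_mul_distrib]
  exact prod_congr rfl fun i _ => (neg_one_mul _).symm

/-- `(-1)^{n-k} = (-1)ⁿ (-1)ᵏ` for `k ≤ n`. [folklore] -/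
private theorem neg_one_pow_sub {A : Type*} [CommRing A] {n k : ℕ} (hk : k ≤ n) :
    ((-1 : A)) ^ (n - k) = (-1) ^ n * (-1) ^ k := by
  have hsq : ((-1 : A) ^ k) * (-1) ^ k = 1 := by rw [← mul_pow]; norm_num
  have h1 : ((-1 : A) ^ (n - k)) * (-1) ^ k = (-1) ^ n := by rw [← pow_add, Nat.sub_add_cancel hk]
  calc ((-1 : A) ^ (n - k)) = (-1) ^ (n - k) * ((-1) ^ k * (-1) ^ k) := by rw [hsq, mul_one]
    _ = (-1) ^ n * (-1) ^ k := by rw [← mul_assoc, h1]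

end Basics

/-! ## §2 The real symbol, the sign change `w ↦ -w`, and the complexification -/

section Symbol

variable [Fintype σ] [DecidableEq σ]

/-- **The (algebraic) symbol of a real operator**, multi-affine case: `G_T(z,w) = T[(z+w)^{[n]}] =
Σ_{S ⊆ [n]} T[z^S] w^{[n]∖S} ∈ ℝ[z,w]` (variables `σ ⊕ σ`, `Sum.inl` = `z`, `Sum.inr` = `w`), the real
twin of the tree's `multiAffineSymbol`. [cite: BorceaBranden2009, §1.1 (definition of G_T), Thm. 1.2 (b)] -/
def realMultiAffineSymbol (T : MvPolynomial σ ℝ →ₗ[ℝ] MvPolynomial σ ℝ) : MvPolynomial (σ ⊕ σ) ℝ :=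
  ∑ S : Finset σ, rename Sum.inl (T (∏ i ∈ S, X i)) * ∏ i ∈ Sᶜ, X (Sum.inr i)

omit [Fintype σ] [DecidableEq σ] in
/-- **The sign change `w ↦ -w`** on `R[z,w]` (`z`-variables `Sum.inl` fixed), so that `G_T(z,-w)` of
Thm. 1.2 (c) is `negInr (realMultiAffineSymbol T)`. [cite: BorceaBranden2009, §1.1 Thm. 1.2 (c)] -/
def negInr {R : Type*} [CommRing R] : MvPolynomial (σ ⊕ σ) R →ₐ[R] MvPolynomial (σ ⊕ σ) R :=
  bind₁ (Sum.elim (fun i => X (Sum.inl i)) fun i => -X (Sum.inr i))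

omit [Fintype σ] [DecidableEq σ] in
/-- `negInr` commutes with complexification. [cite: BorceaBranden2009, §1.1 Thm. 1.2 (c)] -/
theorem map_negInr (q : MvPolynomial (σ ⊕ σ) ℝ) :
    map (algebraMap ℝ ℂ) (negInr q) = negInr (map (algebraMap ℝ ℂ) q) := by
  rw [negInr, negInr, map_bind₁]
  have h : (fun v : σ ⊕ σ => map (algebraMap ℝ ℂ)
      (Sum.elim (fun i => X (Sum.inl i)) (fun i => -X (Sum.inr i)) v)) =
      Sum.elim (fun i => X (Sum.inl i)) (fun i => -X (Sum.inr i)) := by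
    funext v
    rcases v with i | i <;> simp
  rw [h]

omit [Fintype σ] [DecidableEq σ] in
/-- `(negInr q)(z, w) = q(z, -w)`. [cite: BorceaBranden2009, §1.1 Thm. 1.2 (c)] -/
theorem eval_negInr (z w : σ → ℂ) (q : MvPolynomial (σ ⊕ σ) ℂ) :
    eval (Sum.elim z w) (negInr q) = eval (Sum.elim z (-w)) q := by
  rw [negInr, eval_bind₁]
  have h : (fun v : σ ⊕ σ => eval (Sum.elim z w)
      (Sum.elim (fun i => X (Sum.inl i)) (fun i => -X (Sum.inr i)) v)) = Sum.elim z (-w) := by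
    funext v
    rcases v with i | i <;> simp
  rw [h]

omit [Fintype σ] [DecidableEq σ] in
/-- `negInr` fixes the `z`-part. [cite: BorceaBranden2009, §1.1 Thm. 1.2 (c)] -/
theorem negInr_rename_inl {R : Type*} [CommRing R] (p : MvPolynomial σ R) :
    negInr (rename Sum.inl p) = rename Sum.inl p := by
  induction p using MvPolynomial.induction_on with
  | C a => rw [rename_C, negInr, bind₁_C_right]
  | add p q hp hq => rw [map_add, map_add, hp, hq]
  | mul_X p i hp => rw [map_mul, map_mul, hp, rename_X, negInr, bind₁_X_right, Sum.elim_inl]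

omit [Fintype σ] [DecidableEq σ] in
/-- `negInr` negates the `w`-monomials: `negInr (w^A) = (-1)^{|A|} w^A`. [cite: BorceaBranden2009, §1.1
Thm. 1.2 (c)] -/
theorem negInr_prod_X_inr {R : Type*} [CommRing R] (A : Finset σ) :
    negInr (∏ i ∈ A, X (Sum.inr i) : MvPolynomial (σ ⊕ σ) R) = C ((-1) ^ A.card) * ∏ i ∈ A, X (Sum.inr i) := by
  rw [negInr, map_prod]
  simp only [bind₁_X_right, Sum.elim_inr]
  rw [prod_neg_eq, map_pow, map_neg, map_one]

omit [Fintype σ] [DecidableEq σ] in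
/-- **The complexification `T_ℂ`** of an `ℝ`-linear operator on `ℝ[z_σ]`: the `ℂ`-linear operator on
`ℂ[z_σ]` with `T_ℂ(z^α) = T(z^α)` (defined on the monomial basis). [cite: BorceaBranden2009, §4 proof of
Thm. 1.2 (`T(F) + iT(G) = G_T(z,W)`: `T` applied to complex polynomials through real and imaginary parts)] -/
def complexify (T : MvPolynomial σ ℝ →ₗ[ℝ] MvPolynomial σ ℝ) : MvPolynomial σ ℂ →ₗ[ℂ] MvPolynomial σ ℂ :=
  (basisMonomials σ ℂ).constr ℂ fun m => map (algebraMap ℝ ℂ) (T (monomial m 1))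

omit [Fintype σ] [DecidableEq σ] in
/-- `T_ℂ` on monomials. [cite: BorceaBranden2009, §4 proof of Thm. 1.2] -/
theorem complexify_monomial (T : MvPolynomial σ ℝ →ₗ[ℝ] MvPolynomial σ ℝ) (m : σ →₀ ℕ) (c : ℂ) :
    complexify T (monomial m c) = c • map (algebraMap ℝ ℂ) (T (monomial m 1)) := by
  have h : (monomial m c : MvPolynomial σ ℂ) = c • basisMonomials σ ℂ m := by
    rw [coe_basisMonomials, smul_monomial, smul_eq_mul, mul_one]
  rw [h, map_smul, complexify, Module.Basis.constr_basis]

omit [Fintype σ] [DecidableEq σ] in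
/-- **`T_ℂ` extends `T`**: `T_ℂ(f) = T(f)` for real `f`. [cite: BorceaBranden2009, §4 proof of Thm. 1.2] -/
theorem complexify_map (T : MvPolynomial σ ℝ →ₗ[ℝ] MvPolynomial σ ℝ) (f : MvPolynomial σ ℝ) :
    complexify T (map (algebraMap ℝ ℂ) f) = map (algebraMap ℝ ℂ) (T f) := by
  induction f using MvPolynomial.induction_on' with
  | monomial m a =>
    rw [map_monomial, complexify_monomial,
      show (monomial m a : MvPolynomial σ ℝ) = a • monomial m 1 by rw [smul_monomial, smul_eq_mul, mul_one],
      LinearMap.map_smul, smul_eq_C_mul, smul_eq_C_mul, (MvPolynomial.map (algebraMap ℝ ℂ)).map_mul, map_C]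
  | add p q hp hq => rw [map_add, map_add, hp, hq, map_add, map_add]

/-- **`G_{T_ℂ} = G_T`**: the complex symbol of `T_ℂ` is the complexified real symbol of `T`.
[cite: BorceaBranden2009, §1.1 (G_T) and §4 proof of Thm. 1.2] -/
theorem multiAffineSymbol_complexify (T : MvPolynomial σ ℝ →ₗ[ℝ] MvPolynomial σ ℝ) :
    multiAffineSymbol (complexify T) = map (algebraMap ℝ ℂ) (realMultiAffineSymbol T) := by
  rw [multiAffineSymbol, realMultiAffineSymbol, map_sum]
  refine sum_congr rfl fun S _ => ?_
  rw [_root_.map_mul (MvPolynomial.map (algebraMap ℝ ℂ)), map_rename, ← complexify_map,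
    _root_.map_prod (MvPolynomial.map (algebraMap ℝ ℂ)), _root_.map_prod (MvPolynomial.map (algebraMap ℝ ℂ))]
  simp only [map_X]

omit [DecidableEq σ] in
/-- `T` is `ℝ`-linear on the coefficient form: `T(Σ_S a(S) z^S) = Σ_S a(S) T(z^S)`.
[cite: BorceaBranden2009, §2.1 (multi-affine `Σ_S a(S) z^S`)] -/
theorem apply_multiAffine (T : MvPolynomial σ ℝ →ₗ[ℝ] MvPolynomial σ ℝ) (a : Finset σ → ℝ) :
    T (multiAffine a) = ∑ S : Finset σ, a S • T (∏ i ∈ S, X i) := by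
  rw [multiAffine, map_sum]
  exact sum_congr rfl fun S _ => by rw [← smul_eq_C_mul, map_smul]

/-- **The symbol at a point `W`**: `G_T(·, W) = Σ_S W^{[n]∖S} · T(z^S) ∈ ℂ[z]` (`= T_ℂ[(z+W)^{[n]}]`,
`symbolAt_eq_complexify`). [cite: BorceaBranden2009, §4 proof of Thm. 1.2 ("consider
`G_T(z,w) = T[(z+w)^κ]` and let `W ∈ {Im > 0}ⁿ`")] -/
def symbolAt (T : MvPolynomial σ ℝ →ₗ[ℝ] MvPolynomial σ ℝ) (W : σ → ℂ) : MvPolynomial σ ℂ :=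
  ∑ S : Finset σ, (∏ i ∈ Sᶜ, W i) • map (algebraMap ℝ ℂ) (T (∏ i ∈ S, X i))

/-- The **real part of `(z+W)^{[n]}`**: `F_W = Σ_S Re(W^{[n]∖S}) z^S ∈ ℝ[z]`.
[cite: BorceaBranden2009, §4 proof of Thm. 1.2 ("`(z+W)^κ = F(z) + iG(z)`, `F, G ∈ ℝ_κ[z_1,…,z_n]`")] -/
def reProdXAddC (W : σ → ℂ) : MvPolynomial σ ℝ :=
  multiAffine fun S => (∏ i ∈ Sᶜ, W i).re

/-- The **imaginary part of `(z+W)^{[n]}`**: `G_W = Σ_S Im(W^{[n]∖S}) z^S ∈ ℝ[z]`.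
[cite: BorceaBranden2009, §4 proof of Thm. 1.2] -/
def imProdXAddC (W : σ → ℂ) : MvPolynomial σ ℝ :=
  multiAffine fun S => (∏ i ∈ Sᶜ, W i).im

/-- `F_W` is multi-affine. [cite: BorceaBranden2009, §4 proof of Thm. 1.2 (`F ∈ ℝ_κ[z]`)] -/
theorem isMultiAffine_reProdXAddC (W : σ → ℂ) : IsMultiAffine (reProdXAddC W) :=
  isMultiAffine_multiAffine_real _

/-- `G_W` is multi-affine. [cite: BorceaBranden2009, §4 proof of Thm. 1.2 (`G ∈ ℝ_κ[z]`)] -/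
theorem isMultiAffine_imProdXAddC (W : σ → ℂ) : IsMultiAffine (imProdXAddC W) :=
  isMultiAffine_multiAffine_real _

/-- `(z+W)^{[n]} = F_W + i G_W`. [cite: BorceaBranden2009, §4 proof of Thm. 1.2] -/
theorem map_reProdXAddC_add (W : σ → ℂ) :
    map (algebraMap ℝ ℂ) (reProdXAddC W) + C Complex.I * map (algebraMap ℝ ℂ) (imProdXAddC W) =
      ∏ i, (X i + C (W i)) := by
  rw [reProdXAddC, imProdXAddC, map_multiAffine, map_multiAffine, prod_X_add_C_eq, multiAffine,
    multiAffine, mul_sum, ← sum_add_distrib]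
  refine sum_congr rfl fun S _ => ?_
  rw [smul_eq_C_mul, ← mul_assoc, ← add_mul, ← map_mul, ← map_add]
  congr 2
  simp only [Function.comp_apply, Complex.coe_algebraMap]
  rw [mul_comm, Complex.re_add_im]

/-- **`G_T(·,W) = T(F_W) + i T(G_W)`.** [cite: BorceaBranden2009, §4 proof of Thm. 1.2
("`T(F) + iT(G) = G_T(z,W)`")] -/
theorem symbolAt_eq (T : MvPolynomial σ ℝ →ₗ[ℝ] MvPolynomial σ ℝ) (W : σ → ℂ) :
    symbolAt T W = map (algebraMap ℝ ℂ) (T (reProdXAddC W)) +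
      C Complex.I * map (algebraMap ℝ ℂ) (T (imProdXAddC W)) := by
  rw [reProdXAddC, imProdXAddC, apply_multiAffine, apply_multiAffine, map_sum, map_sum, mul_sum,
    ← sum_add_distrib, symbolAt]
  refine sum_congr rfl fun S _ => ?_
  rw [smul_eq_C_mul, smul_eq_C_mul, smul_eq_C_mul, map_mul, map_mul, map_C, map_C, ← mul_assoc, ← add_mul,
    ← map_mul, ← map_add]
  congr 2
  simp only [Complex.coe_algebraMap]
  rw [mul_comm, Complex.re_add_im]

/-- `G_T(·,W) = T_ℂ[(z+W)^{[n]}]`. [cite: BorceaBranden2009, §4 proof of Thm. 1.2] -/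
theorem symbolAt_eq_complexify (T : MvPolynomial σ ℝ →ₗ[ℝ] MvPolynomial σ ℝ) (W : σ → ℂ) :
    symbolAt T W = complexify T (∏ i, (X i + C (W i))) := by
  rw [← map_reProdXAddC_add, map_add, ← smul_eq_C_mul, LinearMap.map_smul, complexify_map, complexify_map,
    smul_eq_C_mul, symbolAt_eq]

/-- **Evaluating the real symbol**: `G_T(z, W) = G_T(·,W)(z)`.
[cite: BorceaBranden2009, §1.1 (G_T(z,w) = T[(z+w)^κ]) and §4 proof of Thm. 1.2] -/
theorem eval_map_realMultiAffineSymbol (T : MvPolynomial σ ℝ →ₗ[ℝ] MvPolynomial σ ℝ) (z w : σ → ℂ) :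
    eval (Sum.elim z w) (map (algebraMap ℝ ℂ) (realMultiAffineSymbol T)) = eval z (symbolAt T w) := by
  rw [← multiAffineSymbol_complexify, eval_multiAffineSymbol, ← symbolAt_eq_complexify]

/-- `G_T(·,W) = 0` iff `T(F_W) = T(G_W) = 0`. [cite: BorceaBranden2009, §4 proof of Thm. 1.2 ("the case
`a = b = 0`")] -/
theorem symbolAt_eq_zero_iff (T : MvPolynomial σ ℝ →ₗ[ℝ] MvPolynomial σ ℝ) (W : σ → ℂ) :
    symbolAt T W = 0 ↔ T (imProdXAddC W) = 0 ∧ T (reProdXAddC W) = 0 := by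
  rw [symbolAt_eq, map_add_C_I_mul_map_eq_zero_iff]

end Symbol

/-! ## §3 The reflection `f(z) ↦ f(-z)`, the twisted operator, and Proposition 4.1 -/

section Reflection

/-- **`f(z) ↦ f(-z)`** on `R[z_σ]` (the map defining `𝓗_n^-(ℂ) = {f(-z) : f ∈ 𝓗_n(ℂ)}`).
[cite: BorceaBranden2009, §4 (definition of 𝓗_n^-(ℂ))] -/
def negVars {R : Type*} [CommRing R] : MvPolynomial σ R →ₐ[R] MvPolynomial σ R :=
  bind₁ fun i => -X i

/-- `negVars` commutes with complexification. [cite: BorceaBranden2009, §4 (𝓗_n^-)] -/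
theorem map_negVars (f : MvPolynomial σ ℝ) :
    map (algebraMap ℝ ℂ) (negVars f) = negVars (map (algebraMap ℝ ℂ) f) := by
  rw [negVars, negVars, map_bind₁]
  have h : (fun i : σ => map (algebraMap ℝ ℂ) (-X i : MvPolynomial σ ℝ)) = fun i => -X i := by
    funext i
    rw [map_neg, map_X]
  rw [h]

/-- `(negVars p)(z) = p(-z)`. [cite: BorceaBranden2009, §4 (𝓗_n^-(ℂ) = {f(-z)})] -/
theorem eval_negVars (z : σ → ℂ) (p : MvPolynomial σ ℂ) : eval z (negVars p) = eval (-z) p := by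
  rw [negVars, eval_bind₁]
  have h : (fun i : σ => eval z (-X i : MvPolynomial σ ℂ)) = -z := by
    funext i
    rw [map_neg, eval_X, Pi.neg_apply]
  rw [h]

/-- `negVars` is an involution. [cite: BorceaBranden2009, §4] -/
theorem negVars_negVars {R : Type*} [CommRing R] (f : MvPolynomial σ R) : negVars (negVars f) = f := by
  rw [negVars, bind₁_bind₁]
  have : (fun i : σ => bind₁ (fun i => -X i) (-X i : MvPolynomial σ R)) = X := by
    funext i
    rw [map_neg, bind₁_X_right, neg_neg]
  rw [this, bind₁_X_left, AlgHom.id_apply]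

/-- `negVars` on constants. [cite: BorceaBranden2009, §4] -/
theorem negVars_C {R : Type*} [CommRing R] (c : R) : negVars (C c : MvPolynomial σ R) = C c :=
  bind₁_C_right _ _

/-- `negVars (z^S) = (-1)^{|S|} z^S`. [cite: BorceaBranden2009, §4 proof of Thm. 1.2
("`T'(f)(z) = (-1)^κ T(f(-z))`")] -/
theorem negVars_prod_X {R : Type*} [CommRing R] (S : Finset σ) :
    negVars (∏ i ∈ S, X i : MvPolynomial σ R) = C ((-1) ^ S.card) * ∏ i ∈ S, X i := by
  rw [negVars, map_prod]
  simp only [bind₁_X_right]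
  rw [prod_neg_eq, map_pow, map_neg, map_one]

/-- `negVars` preserves multi-affinity. [cite: BorceaBranden2009, §4 (`f(-z)` for `f ∈ ℝ_κ`)] -/
theorem IsMultiAffine.negVars [Fintype σ] {f : MvPolynomial σ ℝ} (hf : IsMultiAffine f) :
    IsMultiAffine (StablePolynomials.negVars f) := by
  classical
  rw [eq_multiAffine_of_isMultiAffine_real hf, multiAffine, map_sum]
  refine IsMultiAffine.sum _ fun S _ => ?_
  rw [map_mul, negVars_C, negVars_prod_X, ← mul_assoc, ← map_mul, ← smul_eq_C_mul]
  exact (isMultiAffine_prod_X S).smul _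

/-- For a REAL polynomial, `f(-z)` is stable iff `f` is: `p(-z) ≠ 0` on `Hⁿ` says `p ≠ 0` on the lower
half-space, which for real coefficients is conjugate to `Hⁿ`. [cite: BorceaBranden2009, §4 proof of
Thm. 1.2 ("they preserve real stability simultaneously")] -/
theorem isRealStable_negVars_iff (f : MvPolynomial σ ℝ) : IsRealStable (negVars f) ↔ IsRealStable f := by
  rw [IsRealStable, IsRealStable, map_negVars]
  constructor
  · intro h z hz h0
    refine h (fun i => -conj (z i)) (fun i => by simpa using hz i) ?_
    rw [eval_negVars]
    have hz' : (-fun i => -conj (z i)) = fun i => conj (z i) := by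
      funext i
      simp
    rw [hz', ← conj_eval_map_eq_eval_conj, h0, map_zero]
  · intro h z hz h0
    rw [eval_negVars] at h0
    refine h (fun i => conj ((-z) i)) (fun i => by simpa using hz i) ?_
    rw [← conj_eval_map_eq_eval_conj, h0, map_zero]

/-- The easy inclusion of Proposition 4.1: for `p` real stable and `c ≠ 0`, `(c · p)(-z)` is stable
(`ℂ𝓗_n(ℝ) ⊆ 𝓗_n^-(ℂ)`). [cite: BorceaBranden2009, §4 Prop. 4.1 (⊇)] -/
theorem isUpperHalfPlaneStable_negVars_C_mul_map {p : MvPolynomial σ ℝ} (hp : IsRealStable p) {c : ℂ}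
    (hc : c ≠ 0) : IsUpperHalfPlaneStable (negVars (C c * map (algebraMap ℝ ℂ) p)) := by
  rw [map_mul, negVars_C, ← map_negVars]
  exact (isUpperHalfPlaneStable_C hc).mul ((isRealStable_negVars_iff p).2 hp)

variable [Fintype σ]

/-- **Borcea–Brändén I, Proposition 4.1**: `𝓗_n(ℂ) ∩ 𝓗_n^-(ℂ) = ℂ𝓗_n(ℝ)` — if `h = u + iv` (`u, v` real) is
stable and `h(-z)` is stable too, then `h = c · p` with `c ∈ ℂ` and `p` real stable. Proof as printed:
stability of `h` is `v ≪ u`, stability of `h(-z)` gives (conjugating) `u ≪ v`, and Corollary 1.10 makes `u, v`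
proportional. [cite: BorceaBranden2009, §4 Prop. 4.1] -/
theorem exists_eq_C_mul_map_of_stable_of_stable_negVars (u v : MvPolynomial σ ℝ)
    (h1 : IsUpperHalfPlaneStable (map (algebraMap ℝ ℂ) u + C Complex.I * map (algebraMap ℝ ℂ) v))
    (h2 : IsUpperHalfPlaneStable (negVars (map (algebraMap ℝ ℂ) u + C Complex.I * map (algebraMap ℝ ℂ) v))) :
    ∃ (c : ℂ) (p : MvPolynomial σ ℝ), IsRealStable p ∧
      map (algebraMap ℝ ℂ) u + C Complex.I * map (algebraMap ℝ ℂ) v = C c * map (algebraMap ℝ ℂ) p := by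
  classical
  -- `v ≪ u`
  have hvu : IsProperPosition v u := h1
  -- `u ≪ v`: `u - iv` is stable, by conjugation from the stability of `h(-z)`
  have hneg : IsProperPosition (-v) u := by
    intro z hz h0
    refine h2 (fun i => -conj (z i)) (fun i => by simpa using hz i) ?_
    rw [eval_negVars]
    have hz' : (-fun i => -conj (z i)) = fun i => conj (z i) := by
      funext i
      simp
    rw [hz', map_add, map_mul, eval_C, ← conj_eval_map_eq_eval_conj, ← conj_eval_map_eq_eval_conj]
    rw [map_neg, map_add, map_mul, eval_C, map_neg] at h0
    have hU : eval z (map (algebraMap ℝ ℂ) u) = Complex.I * eval z (map (algebraMap ℝ ℂ) v) := by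
      linear_combination h0
    rw [hU, map_mul, Complex.conj_I]
    ring
  have huv : IsProperPosition u v := by simpa using hneg.swap_neg
  by_cases hu : u = 0
  · subst hu
    refine ⟨Complex.I, v, (isProperPosition_zero_right_iff v).1 hvu, ?_⟩
    rw [map_zero, zero_add]
  · obtain ⟨a, ha⟩ := hvu.exists_eq_C_mul huv hu
    refine ⟨1 + Complex.I * a, u, (hvu.eq_zero_or_isRealStable_right).resolve_left hu, ?_⟩
    rw [ha, map_mul, map_C, map_add, map_one, map_mul, Complex.coe_algebraMap]
    ring

end Reflection

/-! ## §4 Theorem 1.2, sufficiency: each of (a), (b), (c) makes `T` preserve real stability -/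

section Sufficiency

variable [Fintype σ]

/-- **(a) ⇒ preserver**: if `T(f) = α(f)P + β(f)Q` on multi-affine `f` with `P ≪ Q`, then every such `T(f)` is
real stable or `0` — by the multivariate Hermite–Kakeya–Obreschkoff theorem (Thm. 1.9: all nonzero
`aP + bQ` are real stable). [cite: BorceaBranden2009, §1.1 Thm. 1.2 ((a) ⇒) and §4 ("it preserves real
stability (by Theorem 1.9)")] -/
theorem realStabilityPreserver_of_rankTwo {T : MvPolynomial σ ℝ →ₗ[ℝ] MvPolynomial σ ℝ}
    {α β : MvPolynomial σ ℝ →ₗ[ℝ] ℝ} {P Q : MvPolynomial σ ℝ} (hPQ : IsProperPosition P Q)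
    (hT : ∀ f, IsMultiAffine f → T f = α f • P + β f • Q) {f : MvPolynomial σ ℝ} (hf : IsMultiAffine f) :
    IsRealStable (T f) ∨ T f = 0 := by
  rw [hT f hf, smul_eq_C_mul, smul_eq_C_mul]
  exact (hPQ.pencil (α f) (β f)).symm

/-- **The twisted operator** `T'(f)(z) = (-1)ⁿ T(f(-z))` (`n = |σ|`), whose symbol is `G_T(z,-w)`.
[cite: BorceaBranden2009, §4 proof of Thm. 1.2 ("if `G_{T'}(z,w) = G_T(z,-w)` then
`T'(f)(z) = (-1)^κ T(f(-z))`")] -/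
def negTwist (T : MvPolynomial σ ℝ →ₗ[ℝ] MvPolynomial σ ℝ) : MvPolynomial σ ℝ →ₗ[ℝ] MvPolynomial σ ℝ :=
  ((-1 : ℝ) ^ Fintype.card σ) •
    (T ∘ₗ (negVars : MvPolynomial σ ℝ →ₐ[ℝ] MvPolynomial σ ℝ).toLinearMap)

/-- `T'(f) = (-1)ⁿ T(f(-z))`. [cite: BorceaBranden2009, §4 proof of Thm. 1.2] -/
theorem negTwist_apply (T : MvPolynomial σ ℝ →ₗ[ℝ] MvPolynomial σ ℝ) (f : MvPolynomial σ ℝ) :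
    negTwist T f = ((-1 : ℝ) ^ Fintype.card σ) • T (negVars f) := rfl

variable [DecidableEq σ]

/-- **(b) ⇒ preserver**: if the real symbol `G_T(z,w)` is real stable then `T` maps real stable multi-affine
polynomials to real stable polynomials or `0` — the complex Lemma 2.2 / Thm. 1.1 sufficiency (tree
`multiAffine_stabilityPreserver_sufficiency`) applied to `T_ℂ`, whose symbol is `G_T`.
[cite: BorceaBranden2009, §1.1 Thm. 1.2 ((b) ⇒) and §4 ("the desired conclusion simply follows from the
complex case")] -/
theorem realStabilityPreserver_of_symbol {T : MvPolynomial σ ℝ →ₗ[ℝ] MvPolynomial σ ℝ}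
    (hG : IsRealStable (realMultiAffineSymbol T)) {f : MvPolynomial σ ℝ} (hf : IsMultiAffine f)
    (hs : IsRealStable f) : IsRealStable (T f) ∨ T f = 0 := by
  have hG' : IsUpperHalfPlaneStable (multiAffineSymbol (complexify T)) := by
    rw [multiAffineSymbol_complexify]
    exact hG
  have h := multiAffine_stabilityPreserver_sufficiency (complexify T) hG' (isMultiAffine_map_algebraMap hf) hs
  rw [complexify_map] at h
  rcases h with h | h
  · exact Or.inl h
  · exact Or.inr (map_injective (algebraMap ℝ ℂ) (algebraMap ℝ ℂ).injective (by rw [h, map_zero]))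

/-- **`G_{T'}(z,w) = G_T(z,-w)`.** [cite: BorceaBranden2009, §4 proof of Thm. 1.2 ("if … `T, T'` … are
linear operators whose symbols satisfy `G_{T'}(z,w) = G_T(z,-w)` then … `T'(f)(z) = (-1)^κ T(f(-z))`")] -/
theorem realMultiAffineSymbol_negTwist (T : MvPolynomial σ ℝ →ₗ[ℝ] MvPolynomial σ ℝ) :
    realMultiAffineSymbol (negTwist T) = negInr (realMultiAffineSymbol T) := by
  rw [realMultiAffineSymbol, realMultiAffineSymbol, map_sum]
  refine sum_congr rfl fun S _ => ?_
  rw [negTwist_apply, negVars_prod_X, ← smul_eq_C_mul, LinearMap.map_smul, smul_smul, map_smul, map_mul,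
    negInr_rename_inl, negInr_prod_X_inr, card_compl, neg_one_pow_sub (card_le_univ S), smul_mul_assoc,
    smul_eq_C_mul, map_mul]
  ring

/-- **(c) ⇒ preserver**: if `G_T(z,-w)` is real stable then `T` preserves real stability on multi-affine
polynomials — (b) for the twisted operator `T'`, and `T(f) = (-1)ⁿ T'(f(-z))` with `f(-z)` real stable
and multi-affine along with `f`. [cite: BorceaBranden2009, §1.1 Thm. 1.2 ((c) ⇒) and §4 ("they preserve
real stability simultaneously")] -/
theorem realStabilityPreserver_of_symbol_neg {T : MvPolynomial σ ℝ →ₗ[ℝ] MvPolynomial σ ℝ}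
    (hG : IsRealStable (negInr (realMultiAffineSymbol T))) {f : MvPolynomial σ ℝ} (hf : IsMultiAffine f)
    (hs : IsRealStable f) : IsRealStable (T f) ∨ T f = 0 := by
  rw [← realMultiAffineSymbol_negTwist] at hG
  have h := realStabilityPreserver_of_symbol hG hf.negVars ((isRealStable_negVars_iff f).2 hs)
  rw [negTwist_apply, negVars_negVars] at h
  have hc : ((-1 : ℝ) ^ Fintype.card σ) ≠ 0 := pow_ne_zero _ (neg_ne_zero.2 one_ne_zero)
  rw [smul_eq_C_mul, isRealStable_C_mul_iff hc] at h
  rcases h with h | h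
  · exact Or.inl h
  · exact Or.inr ((mul_eq_zero.1 h).resolve_left (mt C_eq_zero.1 hc))

/-- **Borcea–Brändén I, Theorem 1.2 for multi-affine polynomials — sufficiency**: each of (a) `T(f) =
α(f)P + β(f)Q` with `P, Q` real stable and `P ≪ Q`, (b) `G_T(z,w)` real stable, (c) `G_T(z,-w)` real
stable implies that `T` maps real stable multi-affine polynomials to real stable polynomials or `0`.
[cite: BorceaBranden2009, §1.1 Thm. 1.2 ("if"), case κ = (1,…,1)] -/
theorem realStabilityPreserver_of_rankTwo_or_symbol (T : MvPolynomial σ ℝ →ₗ[ℝ] MvPolynomial σ ℝ)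
    (h : (∃ (α β : MvPolynomial σ ℝ →ₗ[ℝ] ℝ) (P Q : MvPolynomial σ ℝ), IsRealStable P ∧ IsRealStable Q ∧
          IsProperPosition P Q ∧ ∀ f : MvPolynomial σ ℝ, IsMultiAffine f → T f = α f • P + β f • Q) ∨
        IsRealStable (realMultiAffineSymbol T) ∨ IsRealStable (negInr (realMultiAffineSymbol T)))
    {f : MvPolynomial σ ℝ} (hf : IsMultiAffine f) (hs : IsRealStable f) :
    IsRealStable (T f) ∨ T f = 0 := by
  rcases h with ⟨α, β, P, Q, -, -, hPQ, hT⟩ | h | h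
  · exact realStabilityPreserver_of_rankTwo hPQ hT hf
  · exact realStabilityPreserver_of_symbol h hf hs
  · exact realStabilityPreserver_of_symbol_neg h hf hs

end Sufficiency

end Literature.Combinatorics.StablePolynomials

end
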